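import Summits.QuantumFields.GaugeBoot.TiltedBoxTwoDimGeometry
import Summits.QuantumFields.GaugeBoot.TiltedBoxEvenMidAxisWitness
import HarnessLib

/-!
# The even square tilted box in two dimensions: positive links of the link mirror, the two annuli (gauge-boot, L3 supplement: 2D slab gluing, even side 1/3)

HONEST FRAMING (cell `pub-gaugeboot`, page 1 of every file): the venture produces certified bounds
on lattice expectations at stated coupling, gauge group, dimension and torus size; NOT a mass gap,
NOT a continuum limit, NOT a string tension; NOT Yang–Mills-summit-bearing (barriers
`FixedCouplingUltralocality`, `PerturbativeInvisibility`). Geometric bookkeeping for the POSITIVE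
two-dimensional result `TiltedBoxEvenMidAxisRPTwoDim.lean` (the even-side twin of
`TiltedBoxOddAxisRPTwoDim.lean`); it discharges nothing else.

Setting: the square box `ℤ^d/Γ(2P, 2P, L)`, `P ≥ 2`, in two dimensions (`∀ k, k = i ∨ k = j`), the
LINK mirror `θ : x_i ↦ 1 - x_i` (`midReflect`/`configMidReflect` of the flip `tiltedAxisFlip`,
`TiltedLatticeMidReflection.lean`, `TiltedBoxEvenMidAxisGeometry.lean`) and the closed half
`{1 ≤ x_i ≤ P}` (`IsMidObservable … P (axisCoord d L (2P))`, the shape of `tiltedBox_linkRP` and of the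
negative `not_tiltedBox_midAxisRP`). The mirror has TWO slabs: between the layers `0` and `1` (exact:
`θ y = y + e_i` on the layer `0`) and between `P` and `P + 1` (twisted: `θ y = y + T + e_i`).

* `posBlockM` — the positive links (`j`-links of the layers `1 … P`, `i`-links based in `1 … P-1`);
  `isMidPosLink_iff_mem_posBlockM`; the mirror reads every positive link off the complement
  (`dependsOn_configMidReflect_apply`) — the hypothesis of the tree's mechanism with NO shared block;
* the rungs `(y + t e_j, i)` of the two slabs (`x_i(y) ∈ {0, P}`) are not positive and the mirror image
  of a positive link is never a rung (`configMidReflect_update_rung`); the `j`-links of the layers `1`, `P`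
  are positive (`jLink_mem_posBlockM`);
* every slab `SquareSlab.IsSlabPlaq (x_i y)` of a square box of ANY side `M` in two dimensions is the
  `2M`-annulus `(y + t e_j; i, j)` (`filter_isSlabPlaqSq_eq_image`).

References: K. Osterwalder, E. Seiler, Ann. Phys. 110 (1978) 440, §2; J. Fröhlich, R. Israel,
E. H. Lieb, B. Simon, J. Stat. Phys. 22 (1980) 297, §3.
-/

noncomputable section

open QuotientAddGroup Finset Function

namespace Summit.QuantumFields.GaugeBoot

namespace TiltedRP

namespace TwoDim

variable {d : ℕ} {i j : Fin d} {L : ℕ}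

/-! ## Slabs of a square box of any side are annuli (two dimensions) -/

section AnySide

variable {M : ℕ} [NeZero M] [NeZero L]

/-- **In two dimensions the slab above the layer of `y` is the `2M`-annulus through `y`**:
`{p : SquareSlab.IsSlabPlaq (x_i y) p} = {(y + t e_j; i, j) : t < 2M}`. [folklore] -/
theorem filter_isSlabPlaqSq_eq_image [DecidableEq (TiltedSite d i j M M L)] (hij : i ≠ j)
    (hd : ∀ k : Fin d, k = i ∨ k = j) (y : TiltedSite d i j M M L) :
    Finset.univ.filter (SquareSlab.IsSlabPlaq (axisCoord d L M y)) =
      (Finset.range (2 * M)).image fun t => (cyc y t, dp hij) := by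
  ext p
  obtain ⟨x, q⟩ := p
  simp only [Finset.mem_filter, Finset.mem_univ, true_and, Finset.mem_image, Finset.mem_range,
    SquareSlab.IsSlabPlaq, Prod.mk.injEq]
  constructor
  · rintro ⟨-, hx⟩
    obtain ⟨t, ht, rfl⟩ := exists_eq_cyc_of_axisCoord_eq hij hd (y := y) hx
    exact ⟨t, ht, rfl, (dirPair_eq_dp hij hd q).symm⟩
  · rintro ⟨t, -, rfl, rfl⟩
    exact ⟨mkDirPair_hasDir i j (Ne.symm hij), axisCoord_cyc hij y t⟩

omit [NeZero M] [NeZero L] in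
/-- The annulus parametrisation through `y` is injective on `[0, 2M)`. [folklore] -/
theorem cycAnnulus_injOn (hij : i ≠ j) (y : TiltedSite d i j M M L) :
    Set.InjOn (fun t => (cyc y t, dp hij)) (Finset.range (2 * M) : Set ℕ) := by
  intro s hs t ht h
  simp only [Finset.coe_range, Set.mem_Iio, Prod.mk.injEq] at hs ht h
  exact cyc_inj hij _ hs ht h.1

end AnySide

/-! ## The even box `M = 2P`: positive links of the link mirror -/

section EvenBox

variable {P : ℕ} [NeZero L] [NeZero P]

/-- The POSITIVE links of the link mirror `{1 ≤ x_i ≤ P}`: `j`-links of the layers `1 … P` and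
`i`-links based in the layers `1 … P-1`. -/
def posBlockM (d : ℕ) (i j : Fin d) (L P : ℕ) [NeZero L] [NeZero P] :
    Finset (Link (TiltedSite d i j (2 * P) (2 * P) L) d) :=
  Finset.univ.filter fun l =>
    (l.2 = j ∧ 1 ≤ (axisCoord d L (2 * P) l.1).val ∧ (axisCoord d L (2 * P) l.1).val ≤ P) ∨
    (l.2 = i ∧ 1 ≤ (axisCoord d L (2 * P) l.1).val ∧ (axisCoord d L (2 * P) l.1).val + 1 ≤ P)

/-- Membership in the positive block. [folklore] -/
theorem mem_posBlockM {l : Link (TiltedSite d i j (2 * P) (2 * P) L) d} :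
    l ∈ posBlockM d i j L P ↔
      (l.2 = j ∧ 1 ≤ (axisCoord d L (2 * P) l.1).val ∧ (axisCoord d L (2 * P) l.1).val ≤ P) ∨
      (l.2 = i ∧ 1 ≤ (axisCoord d L (2 * P) l.1).val ∧ (axisCoord d L (2 * P) l.1).val + 1 ≤ P) := by
  simp [posBlockM]

/-- **The positive links of `{1 ≤ x_i ≤ P}` are the block `posBlockM`** (two dimensions, `P ≥ 2`). [folklore] -/
theorem isMidPosLink_iff_mem_posBlockM (hP : 2 ≤ P) (hij : i ≠ j) (hd : ∀ k : Fin d, k = i ∨ k = j)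
    (l : Link (TiltedSite d i j (2 * P) (2 * P) L) d) :
    IsMidPosLink (tiltedUnit d i j (2 * P) (2 * P) L) P (axisCoord d L (2 * P)) l ↔ l ∈ posBlockM d i j L P := by
  obtain ⟨x, k⟩ := l
  have hc := val_lt_two_mul hP (axisCoord d L (2 * P) x)
  rw [mem_posBlockM, IsMidPosLink, InMidHalf, InMidHalf, axisCoord_add_tiltedUnit]
  simp only
  rcases hd k with hk | hk
  · rw [hk, if_pos rfl, val_add_one hP]
    simp only [hij, false_and, false_or, true_and]
    by_cases h : (axisCoord d L (2 * P) x).val + 1 = 2 * P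
    · rw [if_pos h]
      constructor
      · rintro ⟨-, h1, -⟩; exact absurd h1 (by omega)
      · rintro ⟨-, h2⟩; exact absurd h2 (by omega)
    · rw [if_neg h]
      constructor
      · rintro ⟨⟨h1, -⟩, -, h3⟩; exact ⟨h1, h3⟩
      · rintro ⟨h1, h2⟩; exact ⟨⟨h1, by omega⟩, by omega, h2⟩
  · rw [hk, if_neg (Ne.symm hij), add_zero]
    simp only [Ne.symm hij, false_and, or_false, true_and, and_self]

/-- **The mirror reads a positive link off the complement of the positive block.** [folklore] -/
theorem midLinkMap_not_mem_posBlockM (hP : 2 ≤ P) (hij : i ≠ j) (hd : ∀ k : Fin d, k = i ∨ k = j)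
    {l : Link (TiltedSite d i j (2 * P) (2 * P) L) d} (hl : l ∈ posBlockM d i j L P) :
    midLinkMap (tiltedUnit d i j (2 * P) (2 * P) L) i (tiltedAxisFlip d L (2 * P) hij) l ∉ posBlockM d i j L P := by
  obtain ⟨x, k⟩ := l
  intro hmem
  have hc := val_lt_two_mul hP (axisCoord d L (2 * P) x)
  rcases hd k with hk | hk
  · -- `i`-link: image `(σ x, i)`, coordinate `-x_i`
    rw [hk] at hl hmem
    rw [midLinkMap_self, mem_posBlockM] at hmem
    rw [mem_posBlockM] at hl
    simp only [hij, false_and, false_or, true_and] at hl hmem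
    rw [val_axisCoord_tiltedAxisFlip d L P hP hij] at hmem
    split_ifs at hmem with h0 <;> omega
  · -- `j`-link: image `(θ x, j)`, coordinate `1 - x_i`
    rw [hk] at hl hmem
    rw [midLinkMap_other _ i _ x (Ne.symm hij), mem_posBlockM] at hmem
    rw [mem_posBlockM] at hl
    simp only [Ne.symm hij, false_and, or_false, true_and] at hl hmem
    rw [val_axisCoord_midReflect d L P hP hij] at hmem
    split_ifs at hmem with h1 <;> omega

/-- The reflected value of a positive link depends only on the links off the positive block. [folklore] -/
theorem dependsOn_configMidReflect_apply {G : Type*} [Group G] [DecidableEq (TiltedSite d i j (2 * P) (2 * P) L)]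
    (hP : 2 ≤ P) (hij : i ≠ j) (hd : ∀ k : Fin d, k = i ∨ k = j)
    (l : Link (TiltedSite d i j (2 * P) (2 * P) L) d) (hl : l ∈ posBlockM d i j L P ∪ ∅) :
    DependsOn (fun U : Config (TiltedSite d i j (2 * P) (2 * P) L) d G =>
        configMidReflect (tiltedUnit d i j (2 * P) (2 * P) L) i (tiltedAxisFlip d L (2 * P) hij) U l)
      (((posBlockM d i j L P)ᶜ : Finset _) : Set _) := by
  rw [Finset.union_empty] at hl
  intro U V h
  have hmem : midLinkMap (tiltedUnit d i j (2 * P) (2 * P) L) i (tiltedAxisFlip d L (2 * P) hij) l ∈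
      (((posBlockM d i j L P)ᶜ : Finset _) : Set _) := by
    rw [Finset.coe_compl, Set.mem_compl_iff, Finset.mem_coe]
    exact midLinkMap_not_mem_posBlockM hP hij hd hl
  have hUV := h _ hmem
  show configMidReflect _ i _ U l = configMidReflect _ i _ V l
  unfold configMidReflect
  split_ifs <;> simp [hUV]

/-! ## The rungs of the two annuli -/

omit [NeZero L] [NeZero P] in
/-- An `i`-link based in the layer `0` or in the layer `P` (a rung of one of the two slabs) is not a
positive link. [folklore] -/
theorem not_isMidPosLink_of_axisCoord (hP : 2 ≤ P) {x : TiltedSite d i j (2 * P) (2 * P) L}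
    (hx : axisCoord d L (2 * P) x = 0 ∨ axisCoord d L (2 * P) x = ((P : ℕ) : ZMod (2 * P))) :
    ¬ IsMidPosLink (tiltedUnit d i j (2 * P) (2 * P) L) P (axisCoord d L (2 * P)) (x, i) := by
  rintro ⟨⟨h1, -⟩, -, h2⟩
  rw [axisCoord_add_tiltedUnit, if_pos rfl, val_add_one hP] at h2
  rcases hx with hx | hx
  · rw [hx, ZMod.val_zero] at h1; omega
  · rw [hx, ZMod.val_natCast, Nat.mod_eq_of_lt (by omega), if_neg (by omega)] at h2; omega

/-- **The mirror image of a positive link is never a rung** (a `j`-link, or an `i`-link `(σ x, i)`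
with `x_i(σ x) = -x_i(x) ∉ {0, P}` since `1 ≤ x_i(x) ≤ P - 1`). [folklore] -/
theorem midLinkMap_ne_rung (hP : 2 ≤ P) (hij : i ≠ j) (hd : ∀ k : Fin d, k = i ∨ k = j)
    {l : Link (TiltedSite d i j (2 * P) (2 * P) L) d}
    (hl : IsMidPosLink (tiltedUnit d i j (2 * P) (2 * P) L) P (axisCoord d L (2 * P)) l)
    {y : TiltedSite d i j (2 * P) (2 * P) L}
    (hy : axisCoord d L (2 * P) y = 0 ∨ axisCoord d L (2 * P) y = ((P : ℕ) : ZMod (2 * P))) (s : ℕ) :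
    midLinkMap (tiltedUnit d i j (2 * P) (2 * P) L) i (tiltedAxisFlip d L (2 * P) hij) l ≠ (cyc y s, i) := by
  obtain ⟨x, k⟩ := l
  rcases hd k with hk | hk
  · rw [hk] at hl ⊢
    rw [midLinkMap_self]
    intro h
    have hx := (isMidPosLink_iff_mem_posBlockM hP hij hd (x, i)).1 hl
    rw [mem_posBlockM] at hx
    simp only [hij, false_and, false_or, true_and] at hx
    have h1 := congrArg (fun l => (axisCoord d L (2 * P) l.1).val) h
    simp only [axisCoord_cyc hij, val_axisCoord_tiltedAxisFlip d L P hP hij] at h1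
    rcases hy with hy | hy
    · rw [hy, ZMod.val_zero] at h1; split_ifs at h1 with h0 <;> omega
    · rw [hy, ZMod.val_natCast, Nat.mod_eq_of_lt (by omega)] at h1; split_ifs at h1 with h0 <;> omega
  · rw [hk, midLinkMap_other _ i _ x (Ne.symm hij)]
    exact fun h => hij (congrArg Prod.snd h).symm

omit [NeZero L] [NeZero P] in
/-- Updating a rung does not change the positive links. [folklore] -/
theorem posLinks_update_rung {G : Type*} [DecidableEq (TiltedSite d i j (2 * P) (2 * P) L)] (hP : 2 ≤ P)
    (hij : i ≠ j) (U : Config (TiltedSite d i j (2 * P) (2 * P) L) d G) {y : TiltedSite d i j (2 * P) (2 * P) L}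
    (hy : axisCoord d L (2 * P) y = 0 ∨ axisCoord d L (2 * P) y = ((P : ℕ) : ZMod (2 * P))) (s : ℕ) (z : G)
    (l : Link (TiltedSite d i j (2 * P) (2 * P) L) d)
    (hl : IsMidPosLink (tiltedUnit d i j (2 * P) (2 * P) L) P (axisCoord d L (2 * P)) l) :
    update U (cyc y s, i) z l = U l := by
  rw [update_of_ne]
  rintro rfl
  exact not_isMidPosLink_of_axisCoord hP (by rw [axisCoord_cyc hij]; exact hy) hl

/-- Updating a rung does not change the REFLECTED positive links. [folklore] -/
theorem configMidReflect_update_rung {G : Type*} [Group G] [DecidableEq (TiltedSite d i j (2 * P) (2 * P) L)]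
    (hP : 2 ≤ P) (hij : i ≠ j) (hd : ∀ k : Fin d, k = i ∨ k = j)
    (U : Config (TiltedSite d i j (2 * P) (2 * P) L) d G) {y : TiltedSite d i j (2 * P) (2 * P) L}
    (hy : axisCoord d L (2 * P) y = 0 ∨ axisCoord d L (2 * P) y = ((P : ℕ) : ZMod (2 * P))) (s : ℕ) (z : G)
    (l : Link (TiltedSite d i j (2 * P) (2 * P) L) d)
    (hl : IsMidPosLink (tiltedUnit d i j (2 * P) (2 * P) L) P (axisCoord d L (2 * P)) l) :
    configMidReflect (tiltedUnit d i j (2 * P) (2 * P) L) i (tiltedAxisFlip d L (2 * P) hij) (update U (cyc y s, i) z) l =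
      configMidReflect (tiltedUnit d i j (2 * P) (2 * P) L) i (tiltedAxisFlip d L (2 * P) hij) U l := by
  unfold configMidReflect
  rw [update_of_ne (midLinkMap_ne_rung hP hij hd hl hy s)]

/-- The `j`-links of the layers `1` and `P` (the letters of the two annulus words on the positive side)
are positive links. [folklore] -/
theorem jLink_mem_posBlockM (hP : 2 ≤ P) {x : TiltedSite d i j (2 * P) (2 * P) L}
    (hx : axisCoord d L (2 * P) x = 1 ∨ axisCoord d L (2 * P) x = ((P : ℕ) : ZMod (2 * P))) :
    (x, j) ∈ posBlockM d i j L P := by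
  rw [mem_posBlockM]
  refine Or.inl ⟨rfl, ?_⟩
  have h1 : (1 : ZMod (2 * P)).val = 1 := val_one_eq hP
  rcases hx with hx | hx
  · rw [hx, h1]; omega
  · rw [hx, ZMod.val_natCast, Nat.mod_eq_of_lt (by omega)]; omega

end EvenBox

end TwoDim

end TiltedRP

end Summit.QuantumFields.GaugeBoot

end
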